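import Mathlib

/-!
# Crux `UniformPhotonSphereChannels` (K1), negative side — calculus of `t`-polynomial slices

Support file of the standing disprover of item stmt-FinalStateConjecture-10045 (kernel census).
Elements of the candidate kernel `P(ρ)` are, on the exterior cone, polynomials in `t`:
`p(t, x) = Σ_{i<n} aᵢ(x) tⁱ`.  This file collects the one-variable facts used to extract and
differentiate the top coefficient:

* derivatives of `t ↦ Σ_{i<n} cᵢ tⁱ` are again of this form with shifted coefficients
  (`hasDerivAt_polySum`, `deriv_polySum`, `iteratedDeriv_two_polySum`), also for functions that
  agree with such a sum only near a point;
* the `n`-th forward difference with step `τ` of a polynomial of degree `≤ n` is `n! τⁿ cₙ`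
  (`sum_smul_polySum_eq`), and it annihilates polynomials of degree `< n`
  (`sum_smul_polySum_eq_zero`).

Coefficient sequences `c : ℕ → ℝ` are normalised to vanish from the summation bound on. [folklore]
-/

namespace Summit.FinalStateConjecture.FinalStateConjecture.Theorems

open Finset Filter Topology fwdDiff

noncomputable section

namespace KernelCensus

/-- Derivative of a polynomial sum: the coefficients shift down,
`(Σ_{i<n} cᵢ tⁱ)' = Σ_{i<n} (i+1) c_{i+1} tⁱ` (for `c` vanishing from `n` on). -/
theorem hasDerivAt_polySum (c : ℕ → ℝ) (n : ℕ) (hc : ∀ i, n ≤ i → c i = 0) (t : ℝ) :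
    HasDerivAt (fun t => ∑ i ∈ range n, c i * t ^ i)
      (∑ i ∈ range n, ((i + 1 : ℕ) : ℝ) * c (i + 1) * t ^ i) t := by
  have h : HasDerivAt (fun t => ∑ i ∈ range n, c i * t ^ i)
      (∑ i ∈ range n, c i * ((i : ℝ) * t ^ (i - 1))) t :=
    HasDerivAt.fun_sum fun i _ => (hasDerivAt_pow i t).const_mul (c i)
  refine h.congr_deriv ?_
  cases n with
  | zero => simp
  | succ m =>
    rw [sum_range_succ', sum_range_succ]
    have h0 : c (m + 1) = 0 := hc (m + 1) le_rfl
    simp only [Nat.cast_zero, zero_mul, mul_zero, add_zero, Nat.add_sub_cancel, h0]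
    refine (sum_congr rfl fun i _ => ?_).trans (by ring)
    push_cast
    ring

/-- The shifted coefficient sequence again vanishes from `n` on. -/
theorem shift_vanishes (c : ℕ → ℝ) (n : ℕ) (hc : ∀ i, n ≤ i → c i = 0) :
    ∀ i, n ≤ i → ((i + 1 : ℕ) : ℝ) * c (i + 1) = 0 := fun i hi => by
  rw [hc (i + 1) (by omega), mul_zero]

/-- `deriv` of a polynomial sum. -/
theorem deriv_polySum (c : ℕ → ℝ) (n : ℕ) (hc : ∀ i, n ≤ i → c i = 0) :
    deriv (fun t => ∑ i ∈ range n, c i * t ^ i)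
      = fun t => ∑ i ∈ range n, ((i + 1 : ℕ) : ℝ) * c (i + 1) * t ^ i :=
  funext fun t => (hasDerivAt_polySum c n hc t).deriv

/-- `iteratedDeriv 2` of a polynomial sum: coefficients shift down twice. -/
theorem iteratedDeriv_two_polySum (c : ℕ → ℝ) (n : ℕ) (hc : ∀ i, n ≤ i → c i = 0) (t : ℝ) :
    iteratedDeriv 2 (fun t => ∑ i ∈ range n, c i * t ^ i) t
      = ∑ i ∈ range n, ((i + 1 : ℕ) : ℝ) * (((i + 1 + 1 : ℕ) : ℝ) * c (i + 1 + 1)) * t ^ i := by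
  rw [iteratedDeriv_succ, iteratedDeriv_one, deriv_polySum c n hc]
  exact (hasDerivAt_polySum (fun i => ((i + 1 : ℕ) : ℝ) * c (i + 1)) n (shift_vanishes c n hc) t).deriv

/-- A function agreeing near `t` with a polynomial sum has the shifted sum as derivative there. -/
theorem deriv_eq_of_eventuallyEq_polySum {f : ℝ → ℝ} (c : ℕ → ℝ) (n : ℕ)
    (hc : ∀ i, n ≤ i → c i = 0) {t : ℝ}
    (hf : f =ᶠ[𝓝 t] fun t => ∑ i ∈ range n, c i * t ^ i) :
    deriv f t = ∑ i ∈ range n, ((i + 1 : ℕ) : ℝ) * c (i + 1) * t ^ i := by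
  rw [hf.deriv_eq]
  exact (hasDerivAt_polySum c n hc t).deriv

/-- A function agreeing near `t` with a polynomial sum is differentiable there with the shifted
sum as derivative. -/
theorem hasDerivAt_of_eventuallyEq_polySum {f : ℝ → ℝ} (c : ℕ → ℝ) (n : ℕ)
    (hc : ∀ i, n ≤ i → c i = 0) {t : ℝ}
    (hf : f =ᶠ[𝓝 t] fun t => ∑ i ∈ range n, c i * t ^ i) :
    HasDerivAt f (∑ i ∈ range n, ((i + 1 : ℕ) : ℝ) * c (i + 1) * t ^ i) t :=
  (hasDerivAt_polySum c n hc t).congr_of_eventuallyEq hf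

/-- … and its second derivative is the twice-shifted sum. -/
theorem iteratedDeriv_two_eq_of_eventuallyEq_polySum {f : ℝ → ℝ} (c : ℕ → ℝ) (n : ℕ)
    (hc : ∀ i, n ≤ i → c i = 0) {t : ℝ}
    (hf : f =ᶠ[𝓝 t] fun t => ∑ i ∈ range n, c i * t ^ i) :
    iteratedDeriv 2 f t
      = ∑ i ∈ range n, ((i + 1 : ℕ) : ℝ) * (((i + 1 + 1 : ℕ) : ℝ) * c (i + 1 + 1)) * t ^ i := by
  rw [hf.iteratedDeriv_eq 2]
  exact iteratedDeriv_two_polySum c n hc t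

/-! ### Forward differences of polynomial sums -/

/-- The binomial finite-difference weights `z_k = (−1)^{n−k} C(n,k)`, applied to the values at
`0, τ, 2τ, …, nτ` of a polynomial sum of degree `< n`, give `0`. -/
theorem sum_smul_polySum_eq_zero (c : ℕ → ℝ) (n : ℕ) (τ : ℝ) :
    ∑ k ∈ range (n + 1), ((-1 : ℤ) ^ (n - k) * (n.choose k : ℤ)) •
        (∑ i ∈ range n, c i * ((k : ℝ) * τ) ^ i) = 0 := by
  set g : ℝ → ℝ := fun r => ∑ i ∈ range n, (c i * τ ^ i) * r ^ i with hg
  have key := fwdDiff_iter_eq_sum_shift (h := (1 : ℝ)) g n 0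
  rw [fwdDiff_iter_sum_mul_pow_eq_zero] at key
  simp only [Pi.zero_apply, zero_add, nsmul_eq_mul, mul_one] at key
  rw [key]
  refine sum_congr rfl fun k _ => ?_
  congr 1
  simp only [hg]
  refine sum_congr rfl fun i _ => ?_
  rw [mul_pow]
  ring

/-- The binomial finite-difference weights applied to the values at `0, τ, …, nτ` of a polynomial
sum of degree `≤ n` extract the top coefficient: the result is `n! τⁿ cₙ`. -/
theorem sum_smul_polySum_eq (c : ℕ → ℝ) (n : ℕ) (τ : ℝ) :
    ∑ k ∈ range (n + 1), ((-1 : ℤ) ^ (n - k) * (n.choose k : ℤ)) •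
        (∑ i ∈ range (n + 1), c i * ((k : ℝ) * τ) ^ i) = (n.factorial : ℝ) * τ ^ n * c n := by
  -- split off the top term and use the degree-`< n` case
  have hsplit : ∀ k : ℕ, (∑ i ∈ range (n + 1), c i * ((k : ℝ) * τ) ^ i)
      = (∑ i ∈ range n, c i * ((k : ℝ) * τ) ^ i) + c n * ((k : ℝ) * τ) ^ n := fun k =>
    sum_range_succ _ _
  simp_rw [hsplit, smul_add, sum_add_distrib, sum_smul_polySum_eq_zero c n τ, zero_add]
  -- the top term: `Δ^n (r ↦ rⁿ) = n!`
  set g : ℝ → ℝ := fun r => r ^ n with hg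
  have key := fwdDiff_iter_eq_sum_shift (h := (1 : ℝ)) g n 0
  rw [fwdDiff_iter_eq_factorial] at key
  have hk : ∑ k ∈ range (n + 1), ((-1 : ℤ) ^ (n - k) * (n.choose k : ℤ)) • ((k : ℝ) ^ n)
      = (n.factorial : ℝ) := by
    have : ((n.factorial : ℝ → ℝ)) 0 = (n.factorial : ℝ) := rfl
    rw [← this, key]
    refine sum_congr rfl fun k _ => ?_
    simp [hg]
  calc ∑ k ∈ range (n + 1), ((-1 : ℤ) ^ (n - k) * (n.choose k : ℤ)) • (c n * ((k : ℝ) * τ) ^ n)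
      = (c n * τ ^ n) * ∑ k ∈ range (n + 1), ((-1 : ℤ) ^ (n - k) * (n.choose k : ℤ)) • ((k : ℝ) ^ n) := by
        rw [mul_sum]
        refine sum_congr rfl fun k _ => ?_
        rw [zsmul_eq_mul, zsmul_eq_mul, mul_pow]
        ring
    _ = (n.factorial : ℝ) * τ ^ n * c n := by rw [hk]; ring

/-- Cauchy–Schwarz form used to bound the extracted coefficient in `L²`: for the difference
weights `z` and any values `y`, `(Σ z_k • y_k)² ≤ (Σ z_k²) (Σ y_k²)`. -/
theorem sq_sum_smul_le (n : ℕ) (y : ℕ → ℝ) :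
    (∑ k ∈ range (n + 1), ((-1 : ℤ) ^ (n - k) * (n.choose k : ℤ)) • y k) ^ 2
      ≤ (∑ k ∈ range (n + 1), (((-1 : ℤ) ^ (n - k) * (n.choose k : ℤ) : ℤ) : ℝ) ^ 2)
        * ∑ k ∈ range (n + 1), y k ^ 2 := by
  have h := sum_mul_sq_le_sq_mul_sq (range (n + 1))
    (fun k => (((-1 : ℤ) ^ (n - k) * (n.choose k : ℤ) : ℤ) : ℝ)) y
  simp only [zsmul_eq_mul]
  exact h

end KernelCensus

end

end Summit.FinalStateConjecture.FinalStateConjecture.Theorems
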